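/-
Copyright (c) 2026 the pub-hodgecm-mathlib formalisation cell (harness21).  Prover seat hodgecm-mathlib-K2E1-p12 (g6), Track B ∕ K2-LIT, h413 = `stmt-HodgeConjecture-24833`,
R90-TF section S8 «ContSpec-n½», socket #4′ `sock_S8_resH_spannedByCharLines` (H side), TOP ROW (L), brick (X1) — S8 dealer R90-CS-plan (g3) ruling S8-R250 (3): the FIRST
analytic lemma of «residues are `L²`-limits of pseudo-Eisenstein series whose Mellin profiles concentrate at a pole»: profiles `f_n ∈ C²_c((0,∞))` with `M[f_n](−c₀) = 1`,
`M[f_n](−c) = 0` at the other poles, and Mellin mass on the unitary line `Re s = −½` dominated by `ε_n → 0` times the line function of ONE fixed profile.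
-/
import Summits.HodgeConjecture.HodgeConjecture.Theorems.K2E1MellinPaleyWienerHalfLine   -- ★ (K2E1 lineage): `mellinConvergent_of_tsupport_subset_Ioi` (the `C_c((0,∞))` profile class converges everywhere)
import HarnessLib

/-!
# K2·E1 — `K2E1MellinProfileConcentrationCMTwo`: MELLIN PROFILES CONCENTRATING AT ONE POLE (brick (X1) of the #4′ top-row letter (L), first lemma)

Track B ∕ K2-LIT, crux h413 = `stmt-HodgeConjecture-24833`, route of record `HCCMUnconditional`; cell `hodgecm-mathlib`, R90-TF section S8 «ContSpec-n½», socket #4′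
`sock_S8_resH_spannedByCharLines` (B ED. 7 :494), TOP ROW `(K_max, 1)` of the letter ledger (K2E3-p27 (g4)), letter (L) = ★ p865055 `hL_top_of_bricks` modulo (X1) «the pure-atom
vectors of a self-dual block are spanned by residue classes» and (X2) «their a.e. formulas».  THEOREMS ONLY (no `def`, no `instance`, no `notation`, no named-fact hypothesis, no
`sorry`; default heartbeats); count-neutral; CLOSES NO SOCKET.  GENERIC real analysis (pure Mathlib `mellin` + ★ `K2E1MellinPaleyWienerHalfLine`).

THE MATHEMATICS ([MoeglinWaldspurger1995, II.1.12, IV.1.11]; [Langlands1976, §7]; [Titchmarsh1948, §1.29]).  In ★ M1's model (`R90S8ResHBlockSelfDualModelM1RepsU2`, coordinates ★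
`K2E1ChiSectionPlancherelSelfDualM1CMTwoSqrt`) the brick `[θ_f]` of a profile `f ∈ C²_c((0,∞))` has atom coordinates `√(Cρ_c)·M[f](−c)·v` (`c ∈ S`, the real poles in `(½, σ₀)`) and
line coordinate `t ↦ M[f](−(½+it))·v + s(½−it)·M[f](−(½−it))·v`.  To reach the atom at `c₀` by bricks one needs profiles `f_n` with `M[f_n](−c₀) = 1`, `M[f_n](−c) = 0` (`c ≠ c₀`) and
vanishing line mass.  CONSTRUCTION (exact, no limiting process inside): the DIFFERENCE–DILATION operator `(Δ_c h)(t) := h(e·t) − e^{c}·h(t)` satisfies `M[Δ_c h](s) = (e^{−s} − e^{c})·M[h](s)`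
(Mathlib `mellin_comp_mul_left`), whose factor VANISHES at `s = −c`; so `h := (Π_{c ∈ S∖{c₀}} Δ_c) g` has `M[h](s) = Π_c (e^{−s} − e^{c}) · M[g](s)`, zero at every other pole and non-zero
at `−c₀`; the dilated renormalised profiles `f_n := κ_n·h(eⁿ·)`, `κ_n := e^{−nc₀} ∕ M[h](−c₀)`, have `M[f_n](−c₀) = 1`, `M[f_n](−c) = 0`, and for `Re s = −½`:
`‖M[f_n](s)‖ = e^{n(½−c₀)}·‖M[h](s)‖ ∕ ‖M[h](−c₀)‖ ≤ ε_n·‖M[g](s)‖`, `ε_n := e^{n(½−c₀)}·Π_c (e^{½} + e^{c}) ∕ ‖M[h](−c₀)‖ → 0` since `c₀ > ½` — the line mass dies against the FIXED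
square-integrable line function of `g` (★ `verticalIntegrable_mellin`).
* §1 the brick class `C²_c((0,∞))` is stable under dilation and `Δ_c`; `mellin_comp_mul_left'` (`M[h(a·)](s) = a^{−s}·M[h](s)`), **`mellin_diffDilate`** (`M[Δ_c h] = (e^{−s} − e^{c})·M[h]`).
* §2 **`exists_profile_killing`** — `∃ h ∈ C²_c((0,∞))`, `∀ s, M[h](s) = Π_{c ∈ T} (e^{−s} − e^{c}) · M[g](s)` (Finset induction on the set `T` of poles to kill).
* §3 HEAD **`exists_mellinProfiles_concentrating (S) (hc : ½ < c₀) (hg …) (hG : M[g](−c₀) ≠ 0)`** (`c₀ ∈ S` is not even needed) — the profiles `f_n` and rates `ε_n` with the five clauses above, the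
  bound stated for EVERY `s` with `Re s = −½` (both line points `−(½ ± it)` of ★ M1's `w_f`).
HONEST LABEL: HC_CM is proved only modulo the 7 printed citations (2 remaining named inputs: hLiu418 = `stmt-HodgeConjecture-24832`, h413 = `stmt-HodgeConjecture-24833`) until rung 0
closes; (X1) also needs the `L²`-limit ∕ contour-shift identification of the limiting brick with the residue class, and (L)-top needs (X2); #4′ stays XL; this generic leaf pays
nothing by itself; REL ≠ ★ ≠ WRITTEN ≠ BUILT; count-neutral; unconditional.

## References
* [MoeglinWaldspurger1995] C. Mœglin, J.-L. Waldspurger, *Spectral Decomposition and Eisenstein Series* (1995), II.1.12, IV.1.11.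
* [Langlands1976] R. P. Langlands, *On the Functional Equations Satisfied by Eisenstein Series*, LNM 544 (1976), §7.
* [Titchmarsh1948] E. C. Titchmarsh, *Introduction to the Theory of Fourier Integrals* (2nd ed., 1948), §1.29 (Mellin transforms).
-/

set_option autoImplicit false
-- the mandated namespace repeats the single-problem summit's segment (`HodgeConjecture.HodgeConjecture`)
set_option linter.dupNamespace false

noncomputable section

open MeasureTheory Set Filter Topology Complex
open scoped Real
open Summit.HodgeConjecture.HodgeConjecture.Cruxes.H413.K2E1MellinPaleyWienerHalfLine (mellinConvergent_of_tsupport_subset_Ioi)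

namespace Summit.HodgeConjecture.HodgeConjecture.Cruxes.H413.K2E1MellinProfileConcentrationCMTwo

/-! ## §1 The brick class `C²_c((0,∞))` under dilation and under the difference–dilation operator `Δ_c` -/

section Bricks

variable {h : ℝ → ℂ}

/-- Dilation `t ↦ h(a·t)` preserves `C²`. [cite: Titchmarsh1948, §1.29] -/
theorem contDiff_comp_mul (hh : ContDiff ℝ 2 h) (a : ℝ) : ContDiff ℝ 2 fun t => h (a * t) :=
  hh.comp (contDiff_const.mul contDiff_id)

/-- Dilation by `a ≠ 0` preserves compact support. [cite: Titchmarsh1948, §1.29] -/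
theorem hasCompactSupport_comp_mul (hhs : HasCompactSupport h) {a : ℝ} (ha : a ≠ 0) : HasCompactSupport fun t => h (a * t) :=
  hhs.comp_homeomorph (Homeomorph.mulLeft₀ a ha)

/-- Dilation by `a > 0` keeps the topological support inside `(0,∞)`. [cite: Titchmarsh1948, §1.29] -/
theorem tsupport_comp_mul_subset (hh0 : tsupport h ⊆ Ioi 0) {a : ℝ} (ha : 0 < a) : tsupport (fun t => h (a * t)) ⊆ Ioi 0 := by
  have hφ : (fun t => h (a * t)) = h ∘ (Homeomorph.mulLeft₀ a ha.ne') := rfl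
  rw [tsupport, hφ, Function.support_comp_eq_preimage, ← Homeomorph.preimage_closure]
  intro t ht
  have ht' : a * t ∈ Ioi (0 : ℝ) := hh0 ht
  exact (mul_pos_iff_of_pos_left ha).1 ht'

/-- The Mellin transform of a dilation: `M[h(a·)](s) = a^{−s}·M[h](s)` (Mathlib `mellin_comp_mul_left`, product form). [cite: Titchmarsh1948, §1.29] -/
theorem mellin_comp_mul_left' (h : ℝ → ℂ) (s : ℂ) {a : ℝ} (ha : 0 < a) : mellin (fun t => h (a * t)) s = (a : ℂ) ^ (-s) * mellin h s := by
  rw [mellin_comp_mul_left h s ha, smul_eq_mul]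

/-- The difference–dilation `Δ_c h := h(e·) − e^{c}·h` preserves `C²`. [cite: Titchmarsh1948, §1.29] -/
theorem contDiff_diffDilate (hh : ContDiff ℝ 2 h) (c : ℝ) : ContDiff ℝ 2 fun t => h (rexp 1 * t) - ((rexp c : ℝ) : ℂ) * h t :=
  (contDiff_comp_mul hh _).sub (contDiff_const.mul hh)

/-- `Δ_c` preserves compact support. [cite: Titchmarsh1948, §1.29] -/
theorem hasCompactSupport_diffDilate (hhs : HasCompactSupport h) (c : ℝ) : HasCompactSupport fun t => h (rexp 1 * t) - ((rexp c : ℝ) : ℂ) * h t :=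
  (hasCompactSupport_comp_mul hhs (Real.exp_pos 1).ne').sub hhs.mul_left

/-- `Δ_c` keeps the topological support inside `(0,∞)`. [cite: Titchmarsh1948, §1.29] -/
theorem tsupport_diffDilate_subset (hh0 : tsupport h ⊆ Ioi 0) (c : ℝ) : tsupport (fun t => h (rexp 1 * t) - ((rexp c : ℝ) : ℂ) * h t) ⊆ Ioi 0 := by
  intro t ht
  have hsub : tsupport (fun t => h (rexp 1 * t) - ((rexp c : ℝ) : ℂ) * h t) ⊆ tsupport (fun t => h (rexp 1 * t)) ∪ tsupport (fun t => ((rexp c : ℝ) : ℂ) * h t) := by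
    rw [tsupport, tsupport, tsupport, ← closure_union]
    exact closure_mono (Function.support_sub _ _)
  rcases hsub ht with h1 | h2
  · exact tsupport_comp_mul_subset hh0 (Real.exp_pos 1) h1
  · exact hh0 (closure_mono (Function.support_mul_subset_right _ _) h2)

/-- **`M[Δ_c h](s) = (e^{−s} − e^{c})·M[h](s)`** for `h` continuous with compact support in `(0,∞)` (so every Mellin integral converges, ★ `mellinConvergent_of_tsupport_subset_Ioi`).
[cite: Titchmarsh1948, §1.29] -/
theorem mellin_diffDilate (hhc : Continuous h) (hhs : HasCompactSupport h) (hh0 : tsupport h ⊆ Ioi 0) (c : ℝ) (s : ℂ) :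
    mellin (fun t => h (rexp 1 * t) - ((rexp c : ℝ) : ℂ) * h t) s = (((rexp 1 : ℝ) : ℂ) ^ (-s) - ((rexp c : ℝ) : ℂ)) * mellin h s := by
  have h1 : MellinConvergent (fun t => h (rexp 1 * t)) s :=
    mellinConvergent_of_tsupport_subset_Ioi (hhc.comp (continuous_const.mul continuous_id)) (hasCompactSupport_comp_mul hhs (Real.exp_pos 1).ne')
      (tsupport_comp_mul_subset hh0 (Real.exp_pos 1)) s
  have h2 : MellinConvergent (fun t => ((rexp c : ℝ) : ℂ) * h t) s := by
    have h2' := (mellinConvergent_of_tsupport_subset_Ioi hhc hhs hh0 s).const_smul ((rexp c : ℝ) : ℂ)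
    simpa only [smul_eq_mul] using h2'
  have hsub : mellin (fun t => h (rexp 1 * t) - ((rexp c : ℝ) : ℂ) * h t) s = mellin (fun t => h (rexp 1 * t)) s - mellin (fun t => ((rexp c : ℝ) : ℂ) * h t) s := by
    simp only [mellin, smul_eq_mul, mul_sub]
    exact integral_sub h1 h2
  have hmul : mellin (fun t => ((rexp c : ℝ) : ℂ) * h t) s = ((rexp c : ℝ) : ℂ) * mellin h s := by
    have := mellin_const_smul h s ((rexp c : ℝ) : ℂ)
    simpa only [smul_eq_mul] using this
  rw [hsub, hmul, mellin_comp_mul_left' h s (Real.exp_pos 1), sub_mul]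

end Bricks

/-! ## §2 Killing a finite set of poles exactly -/

/-- **A PROFILE WHOSE MELLIN TRANSFORM CARRIES THE FACTOR `Π_{c ∈ T} (e^{−s} − e^{c})`**: for `g ∈ C²_c((0,∞))` and a finite set `T ⊂ ℝ` there is `h ∈ C²_c((0,∞))` with
`M[h](s) = Π_{c ∈ T} (e^{−s} − e^{c}) · M[g](s)` for EVERY `s` — by iterating `Δ_c` over `T`. [cite: Titchmarsh1948, §1.29] [cite: MoeglinWaldspurger1995, II.1.12] -/
theorem exists_profile_killing (T : Finset ℝ) {g : ℝ → ℂ} (hg : ContDiff ℝ 2 g) (hgs : HasCompactSupport g) (hg0 : tsupport g ⊆ Ioi 0) :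
    ∃ h : ℝ → ℂ, ContDiff ℝ 2 h ∧ HasCompactSupport h ∧ tsupport h ⊆ Ioi 0 ∧
      ∀ s : ℂ, mellin h s = (∏ c ∈ T, ((((rexp 1 : ℝ) : ℂ) ^ (-s) - ((rexp c : ℝ) : ℂ)))) * mellin g s := by
  classical
  refine Finset.induction_on T ⟨g, hg, hgs, hg0, fun s => by rw [Finset.prod_empty, one_mul]⟩ ?_
  intro c T hc ih
  obtain ⟨h, hh, hhs, hh0, hmel⟩ := ih
  refine ⟨fun t => h (rexp 1 * t) - ((rexp c : ℝ) : ℂ) * h t, contDiff_diffDilate hh c, hasCompactSupport_diffDilate hhs c, tsupport_diffDilate_subset hh0 c, fun s => ?_⟩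
  rw [mellin_diffDilate hh.continuous hhs hh0 c s, hmel s, Finset.prod_insert hc, mul_assoc]

/-! ## §3 HEAD: profiles concentrating at one pole -/

/-- **MELLIN PROFILES CONCENTRATING AT THE POLE `c₀`.**  Let `S ⊂ ℝ` be finite, `c₀ > ½` (typically `c₀ ∈ S`), and `g ∈ C²_c((0,∞))` with `M[g](−c₀) ≠ 0`.  Then there are profiles
`f_n ∈ C²_c((0,∞))` and rates `ε_n ≥ 0`, `ε_n → 0`, with `M[f_n](−c₀) = 1`, `M[f_n](−c) = 0` for every other `c ∈ S`, and `‖M[f_n](s)‖ ≤ ε_n·‖M[g](s)‖` for every `s` on the unitary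
line `Re s = −½`.  (`f_n := κ_n·h(eⁿ·)` with `h` from §2 at `T := S ∖ {c₀}`, `κ_n := e^{−nc₀}∕M[h](−c₀)`; `ε_n = e^{n(½−c₀)}·Π_c(e^{½}+e^{c})∕‖M[h](−c₀)‖`.)  In ★ M1's model these are
bricks whose atom coordinates tend to the basis atom at `c₀` while their line coordinates die in `L²` (against ★ `verticalIntegrable_mellin` of `g`).
[cite: MoeglinWaldspurger1995, II.1.12, IV.1.11] [cite: Langlands1976, §7] [cite: Titchmarsh1948, §1.29] -/
theorem exists_mellinProfiles_concentrating (S : Finset ℝ) {c₀ : ℝ} (hc : 1 / 2 < c₀)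
    {g : ℝ → ℂ} (hg : ContDiff ℝ 2 g) (hgs : HasCompactSupport g) (hg0 : tsupport g ⊆ Ioi 0) (hG : mellin g (-(c₀ : ℂ)) ≠ 0) :
    ∃ (f : ℕ → ℝ → ℂ) (ε : ℕ → ℝ),
      (∀ n, ContDiff ℝ 2 (f n)) ∧ (∀ n, HasCompactSupport (f n)) ∧ (∀ n, tsupport (f n) ⊆ Ioi 0) ∧
      (∀ n, mellin (f n) (-(c₀ : ℂ)) = 1) ∧ (∀ n, ∀ c ∈ S, c ≠ c₀ → mellin (f n) (-(c : ℂ)) = 0) ∧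
      (∀ n, 0 ≤ ε n) ∧ Tendsto ε atTop (𝓝 0) ∧
      (∀ (n : ℕ) (s : ℂ), s.re = -(1 / 2) → ‖mellin (f n) s‖ ≤ ε n * ‖mellin g s‖) := by
  classical
  -- §2 at the other poles
  obtain ⟨h, hh, hhs, hh0, hmel⟩ := exists_profile_killing (S.erase c₀) hg hgs hg0
  -- the factor `Π_c (e^{-s} − e^{c})`: at `s = −c₀` it is a non-zero real, at `s = −c` (`c ∈ S ∖ {c₀}`) it vanishes, on `Re s = −½` it is bounded by `B`
  have hfac : ∀ c' : ℝ, (((rexp 1 : ℝ) : ℂ) ^ (-(-(c' : ℂ))) - ((rexp c' : ℝ) : ℂ)) = 0 := fun c' => by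
    rw [neg_neg, ← Complex.ofReal_cpow (Real.exp_pos 1).le, Real.exp_one_rpow, sub_self]
  have hfac' : ∀ c c' : ℝ, (((rexp 1 : ℝ) : ℂ) ^ (-(-(c' : ℂ))) - ((rexp c : ℝ) : ℂ)) = (((rexp c' - rexp c : ℝ)) : ℂ) := fun c c' => by
    rw [neg_neg, ← Complex.ofReal_cpow (Real.exp_pos 1).le, Real.exp_one_rpow, Complex.ofReal_sub]
  set M : ℂ := mellin h (-(c₀ : ℂ)) with hM
  have hM0 : M ≠ 0 := by
    rw [hM, hmel]
    refine mul_ne_zero (Finset.prod_ne_zero_iff.2 fun c hcT => ?_) hG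
    rw [hfac', Complex.ofReal_ne_zero, sub_ne_zero]
    exact fun heq => (Finset.ne_of_mem_erase hcT) (Real.exp_injective heq).symm
  set B : ℝ := ∏ c ∈ S.erase c₀, (rexp (1 / 2) + rexp c) with hB
  have hB0 : 0 ≤ B := Finset.prod_nonneg fun c _ => by positivity
  -- the profiles and the rates
  refine ⟨fun n t => (((rexp (-(n * c₀)) : ℝ) : ℂ) / M) * h (rexp n * t), fun n => rexp (1 / 2 - c₀) ^ n * (B / ‖M‖),
    fun n => contDiff_const.mul (contDiff_comp_mul hh _), fun n => (hasCompactSupport_comp_mul hhs (Real.exp_pos _).ne').mul_left,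
    fun n => fun t ht => tsupport_comp_mul_subset hh0 (Real.exp_pos _) (closure_mono (Function.support_mul_subset_right _ _) ht),
    fun n => ?_, fun n c hcS hcc => ?_, fun n => by positivity, ?_, fun n s hs => ?_⟩
  · -- `M[f_n](−c₀) = 1`
    have hmf : mellin (fun t => (((rexp (-(n * c₀)) : ℝ) : ℂ) / M) * h (rexp n * t)) (-(c₀ : ℂ)) =
        (((rexp (-(n * c₀)) : ℝ) : ℂ) / M) * (((rexp n : ℝ) : ℂ) ^ (-(-(c₀ : ℂ))) * M) := by
      have := mellin_const_smul (fun t => h (rexp n * t)) (-(c₀ : ℂ)) ((((rexp (-(n * c₀)) : ℝ) : ℂ) / M))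
      simp only [smul_eq_mul] at this
      rw [this, mellin_comp_mul_left' h _ (Real.exp_pos _)]
    rw [hmf, neg_neg, ← Complex.ofReal_cpow (Real.exp_pos _).le, ← Real.exp_mul]
    field_simp
    rw [← Complex.ofReal_mul, ← Real.exp_add, neg_add_cancel, Real.exp_zero, Complex.ofReal_one]
  · -- `M[f_n](−c) = 0` at the other poles
    have hcT : c ∈ S.erase c₀ := Finset.mem_erase.2 ⟨hcc, hcS⟩
    have hmf : mellin (fun t => (((rexp (-(n * c₀)) : ℝ) : ℂ) / M) * h (rexp n * t)) (-(c : ℂ)) =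
        (((rexp (-(n * c₀)) : ℝ) : ℂ) / M) * (((rexp n : ℝ) : ℂ) ^ (-(-(c : ℂ))) * mellin h (-(c : ℂ))) := by
      have := mellin_const_smul (fun t => h (rexp n * t)) (-(c : ℂ)) ((((rexp (-(n * c₀)) : ℝ) : ℂ) / M))
      simp only [smul_eq_mul] at this
      rw [this, mellin_comp_mul_left' h _ (Real.exp_pos _)]
    rw [hmf, hmel, Finset.prod_eq_zero hcT (hfac c), zero_mul, mul_zero, mul_zero]
  · -- `ε_n → 0`
    have hr0 : 0 ≤ rexp (1 / 2 - c₀) := (Real.exp_pos _).le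
    have hr1 : rexp (1 / 2 - c₀) < 1 := (Real.exp_lt_exp.2 (show 1 / 2 - c₀ < 0 by linarith)).trans_eq Real.exp_zero
    simpa only [zero_mul] using (tendsto_pow_atTop_nhds_zero_of_lt_one hr0 hr1).mul_const (B / ‖M‖)
  · -- the bound on the unitary line `Re s = −½`
    have hmf : mellin (fun t => (((rexp (-(n * c₀)) : ℝ) : ℂ) / M) * h (rexp n * t)) s =
        (((rexp (-(n * c₀)) : ℝ) : ℂ) / M) * (((rexp n : ℝ) : ℂ) ^ (-s) * mellin h s) := by
      have := mellin_const_smul (fun t => h (rexp n * t)) s ((((rexp (-(n * c₀)) : ℝ) : ℂ) / M))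
      simp only [smul_eq_mul] at this
      rw [this, mellin_comp_mul_left' h _ (Real.exp_pos _)]
    -- norms of the three factors
    set A : ℂ := ((rexp (-(n * c₀)) : ℝ) : ℂ) / M with hA
    have hn1 : ‖A‖ = rexp (-(n * c₀)) / ‖M‖ := by
      rw [hA, norm_div, Complex.norm_real, Real.norm_of_nonneg (Real.exp_pos _).le]
    have hn2 : ‖((rexp n : ℝ) : ℂ) ^ (-s)‖ = rexp (n * (1 / 2)) := by
      rw [Complex.norm_cpow_eq_rpow_re_of_pos (Real.exp_pos _), neg_re, hs, neg_neg, ← Real.exp_mul]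
    have hn3 : ‖mellin h s‖ ≤ B * ‖mellin g s‖ := by
      rw [hmel s, norm_mul, Complex.norm_prod]
      refine mul_le_mul_of_nonneg_right (Finset.prod_le_prod (fun _ _ => norm_nonneg _) fun c _ => ?_) (norm_nonneg _)
      refine (norm_sub_le _ _).trans (add_le_add ?_ ?_)
      · rw [Complex.norm_cpow_eq_rpow_re_of_pos (Real.exp_pos 1), neg_re, hs, neg_neg, Real.exp_one_rpow]
      · rw [Complex.norm_real, Real.norm_of_nonneg (Real.exp_pos _).le]
    have hε : rexp (-(n * c₀)) / ‖M‖ * rexp (n * (1 / 2)) * B = rexp (1 / 2 - c₀) ^ n * (B / ‖M‖) := by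
      rw [← Real.exp_nat_mul, show (n : ℝ) * (1 / 2 - c₀) = -(n * c₀) + n * (1 / 2) by ring, Real.exp_add]
      ring
    calc ‖mellin (fun t => A * h (rexp n * t)) s‖
        = rexp (-(n * c₀)) / ‖M‖ * rexp (n * (1 / 2)) * ‖mellin h s‖ := by rw [hmf, norm_mul, norm_mul, hn1, hn2, mul_assoc]
      _ ≤ rexp (-(n * c₀)) / ‖M‖ * rexp (n * (1 / 2)) * (B * ‖mellin g s‖) := mul_le_mul_of_nonneg_left hn3 (by positivity)
      _ = rexp (1 / 2 - c₀) ^ n * (B / ‖M‖) * ‖mellin g s‖ := by rw [← mul_assoc, hε]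

end Summit.HodgeConjecture.HodgeConjecture.Cruxes.H413.K2E1MellinProfileConcentrationCMTwo

end
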